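import Literature.Probability.RandomPlanarGeometry.HexSAWSurfaceWallBridges
import Mathlib.Analysis.MeanInequalities
import Mathlib.Analysis.Convex.Slope
import Mathlib.Analysis.Calculus.Monotone
import Mathlib.Analysis.Calculus.Deriv.Slope
import Mathlib.Analysis.SpecialFunctions.Sqrt
import HarnessLib

/-!
# The wall-bridge rate of honeycomb SAW at a surface: `β(y)` is non-decreasing and log-convex in `log y`, `β(y) ≤ μ_ℍ √(max(1,y))`,
# and `β(y)/√y` is NON-INCREASING — `β(y) ≤ β(y') ≤ √(y'/y) · β(y)` for `0 < y ≤ y'`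

Topic `Literature/Probability/RandomPlanarGeometry` (continues `HexSAWSurfaceWallBridges.lean` — honeycomb self-avoiding walks in
the brick-wall frame with the adsorbing surface the row `Y = 0`: wall bridges `wbr m`, their weights `WB m y = Σ y^{visits}`, the
supermultiplicative sequence `wallSeq y k = y · WB (2k−2) y` and its Fekete growth rate `wallRate y = β(y)` with
`tendsto_wallU_div` / `eventually_pow_le_wallSeq`).

Sources.  N. R. Beaton, M. Bousquet-Mélou, J. de Gier, H. Duminil-Copin, A. J. Guttmann, *The critical fugacity for surface
adsorption of self-avoiding walks on the honeycomb lattice is `1+√2`*, CMP 326 (2014), §3.1, Proposition 5 (arXiv:1109.0358v5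
p. 9: "It is a log-convex, non-decreasing function of `log y`" and "`μ(y) ≥ max(μ, √y)`"; p. 10, first lines (the sentence starts at the foot of p. 9): "`μ(y) ∼ √y` in
our honeycomb setting", after Rychlewski–Whittington for the square lattice), where `μ(y)` is the half-plane rate; by
J. M. Hammersley, G. M. Torrie, S. G. Whittington, J. Phys. A 15 (1982) 539–571, §2, `μ(y)` is the growth rate of surface
bridges, i.e. the `β(y)` of this file (that identification is the lane's `HexSAWSurfaceYcLimitAllY` / `HexSAWSurfaceWallRateEq`
texts and is NOT used here: every statement below is about `β(y) = wallRate y` itself).  N. Madras, G. Slade, *The Self-Avoiding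
Walk* (1993), §1.2 (Lemma 1.2.2: Fekete).

What is proved here, and its status.  (1) `β` is non-decreasing in `y` and LOG-CONVEX in `log y` (Hölder on the finite sums
`WB m`, then Fekete's limit) — CONSOLIDATION of the printed clauses of Proposition 5, for the wall-bridge rate.  (2) The a priori
bound `β(y) ≤ μ_ℍ · √(max(1,y))` — surface visits happen at EVEN times only (`visits_le_div_two`), so `WB m y ≤ c_m(ℍ) · max(1,y)^{m/2}`.
(3) The main statement, **`wallRate_le_sqrt_mul : 0 < y ≤ y' → β(y') ≤ √(y'/y) · β(y)`**, equivalently `β(y)/√y` is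
non-increasing on `(0, ∞)` (`antitoneOn_wallRate_div_sqrt`): a convex function of `t = log y` lying below the line
`log μ_ℍ + t/2` for `t ≥ 0` has all its chords of slope `≤ 1/2` (`ConvexOn.slope_mono_adjacent`).  Together with (1):
`0 ≤ log β(y') − log β(y) ≤ (log y' − log y)/2`.  (The same inequality also follows term by term — every summand
`y^{visits − m/2}` of `WB m y / y^{m/2}` is non-increasing in `y` because the DENSITY of surface visits is at most `1/2` — which is
the honeycomb instance of the general fact that a free energy minus (maximal energy density)·`log y` is non-increasing, implicit
in the density-function formalism of E. J. Janse van Rensburg, *The Statistical Mechanics of Interacting Walks, Polygons, Animals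
and Vesicles* (2nd ed., 2015), §3.3; here it is derived from (1)–(2).)  Label (lane «pcv-sawmu»): (1)–(2) CONSOLIDATION; (3) an
elementary consequence of the printed structure (log-convexity, order `√y` at infinity, visit density `≤ 1/2`), which we have not
found stated for the honeycomb surface problem — NEW-IN-WRITING (modest) at most; it sharpens the ratio bound
`μ(y') ≤ (y'/y) μ(y)` of the lane's Proposition-5 texts to the exponent `1/2`.

## Contents (namespace `Literature.Probability.RandomPlanarGeometry.SAW.HexBW.Wall`, all PROVED)

* (private `visits_le_div_two` — `visits n ω ≤ n / 2`); `WB_le_card_mul_pow_div_two` — `WB m y ≤ #(saws m) · max(1,y)^{m/2}`;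
* `WB_mono`, `wallSeq_mono`, **`wallRate_mono`** — monotonicity in `y`;
* **`wallRate_le_mul_sqrt`** — `β(y) ≤ μ_ℍ · √(max(1,y))`;
* `WB_rpow_mul_rpow_le`, `wallSeq_rpow_mul_rpow_le` (Hölder), **`wallRate_rpow_mul_rpow_le`** —
  `β(y₁^θ y₂^{1−θ}) ≤ β(y₁)^θ β(y₂)^{1−θ}`, and **`convexOn_log_wallRate_exp`** — `t ↦ log β(eᵗ)` is convex on `ℝ`;
* **`wallRate_le_sqrt_mul`**, `antitoneOn_wallRate_div_sqrt`, `log_wallRate_sub_log_wallRate_mem_Icc`;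
* `monotoneOn_wallRate`, **`continuousOn_wallRate`** (squeeze between `β(y₀)` and `√(y/y₀)·β(y₀)`) and **`ae_differentiableAt_wallRate`**
  (Lebesgue) — Proposition 5's "continuous and almost everywhere differentiable" for the wall-bridge rate `β` itself;
* `mul_deriv_le_half_of_sqrt_law` (calculus: a positive-fugacity law `f(b) ≤ √(b/a) f(a)` forces `y f'(y) ≤ f(y)/2` at every point
  of differentiability) and **`mul_deriv_wallRate_le_half`** — `y · β'(y) ≤ β(y)/2`: the limiting DENSITY of surface visits
  `y ∂ log β/∂y` is at most `1/2` wherever it exists (a.e., by the previous item).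
-/

noncomputable section

open Finset Filter Function
open Literature.Probability.LatticeModels Literature.Probability.Percolation
open _root_.Topology

namespace Literature.Probability.RandomPlanarGeometry.SAW.HexBW.Wall

variable {y : ℝ} {n m : ℕ} {ω : ℕ → Site 2}

/-! ### Surface visits happen at even times only -/

/-- `visits n ω ≤ n / 2`: only EVEN times can be surface visits.  (Kept PRIVATE: the lane's Prop-5 rider file
`HexSAWSurfaceYcProp5Riders` carries the public twin `Wall.visits_le_half`.)
[cite: BeatonBousquetMelouDeGierDuminilCopinGuttmann2014, §3.1 (arXiv v5 p. 8: the surface vertices; p. 9, proof of Proposition 5: "zig-zag walks sticking to the surface" have every other vertex in it)] -/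
private theorem visits_le_div_two (n : ℕ) (ω : ℕ → Site 2) : visits n ω ≤ n / 2 := by
  induction n with
  | zero => simp
  | succ n ih => rw [visits_succ]; split_ifs with h <;> omega

/-- A priori bound with the parity gain: `B^w_m(y) ≤ #(saws m) · max(1,y)^{m/2}`.
[cite: BeatonBousquetMelouDeGierDuminilCopinGuttmann2014, §3.1, Proposition 5 (arXiv v5 pp. 9–10: "μ(y) ∼ √y in our honeycomb setting", top of p. 10)] -/
theorem WB_le_card_mul_pow_div_two (m : ℕ) (hy : 0 ≤ y) : WB m y ≤ #(saws m) * max 1 y ^ (m / 2) := by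
  calc WB m y ≤ ∑ ω ∈ wbr m, max 1 y ^ (m / 2) := Finset.sum_le_sum fun ω _ => by
        calc y ^ visits m ω ≤ max 1 y ^ visits m ω := pow_le_pow_left₀ hy (le_max_right _ _) _
          _ ≤ max 1 y ^ (m / 2) := pow_le_pow_right₀ (le_max_left _ _) (visits_le_div_two m ω)
    _ = #(wbr m) * max 1 y ^ (m / 2) := by rw [Finset.sum_const, nsmul_eq_mul]
    _ ≤ #(saws m) * max 1 y ^ (m / 2) := by
        gcongr
        exact (wbr_subset.trans archs_subset).trans hpw_subset

/-! ### Monotonicity in `y` -/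

/-- `B^w_m` is non-decreasing in `y ≥ 0`. [cite: BeatonBousquetMelouDeGierDuminilCopinGuttmann2014, §3.1, Proposition 5 (arXiv v5 p. 9: "non-decreasing")] -/
theorem WB_mono (m : ℕ) (hy : 0 ≤ y) {y' : ℝ} (hyy' : y ≤ y') : WB m y ≤ WB m y' :=
  Finset.sum_le_sum fun _ _ => pow_le_pow_left₀ hy hyy' _

/-- `d_k(y) = y · B^w_{2k−2}(y)` is non-decreasing in `y > 0`. [cite: BeatonBousquetMelouDeGierDuminilCopinGuttmann2014, §3.1, Proposition 5 (arXiv v5 p. 9: "non-decreasing")] -/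
theorem wallSeq_mono (k : ℕ) (hy : 0 < y) {y' : ℝ} (hyy' : y ≤ y') : wallSeq y k ≤ wallSeq y' k := by
  unfold wallSeq
  split_ifs
  · exact le_rfl
  · exact mul_le_mul hyy' (WB_mono _ hy.le hyy') (WB_nonneg _ hy.le) (hy.le.trans hyy')

/-- Comparison of Fekete limits: if `d_k(y) ≤ d_k(y')` for every `k ≥ 1` then `ℓ(y') ≤ ℓ(y)`.
[cite: MadrasSlade1993, §1.2, Lemma 1.2.2] -/
theorem wallLogLim_le_of_wallSeq_le {y y' : ℝ} (hy : 0 < y) (hy' : 0 < y')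
    (h : ∀ k : ℕ, 1 ≤ k → wallSeq y k ≤ wallSeq y' k) : wallLogLim y' ≤ wallLogLim y := by
  refine le_of_tendsto_of_tendsto (tendsto_wallU_div hy') (tendsto_wallU_div hy) ?_
  filter_upwards [Filter.eventually_ge_atTop 1] with k hk
  have hk' : (0 : ℝ) < k := by exact_mod_cast hk
  apply div_le_div_of_nonneg_right _ hk'.le
  simp only [wallU]
  have := Real.log_le_log (wallSeq_pos hy k) (h k hk)
  linarith

/-- **`β` is non-decreasing**: `0 < y ≤ y' → β(y) ≤ β(y')`.
[cite: BeatonBousquetMelouDeGierDuminilCopinGuttmann2014, §3.1, Proposition 5 (arXiv v5 p. 9: "a log-convex, non-decreasing function of log y"); HammersleyTorrieWhittington1982, §2] -/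
theorem wallRate_mono (hy : 0 < y) {y' : ℝ} (hyy' : y ≤ y') : wallRate y ≤ wallRate y' := by
  have hy' : 0 < y' := lt_of_lt_of_le hy hyy'
  have h := wallLogLim_le_of_wallSeq_le hy hy' fun k _ => wallSeq_mono k hy hyy'
  unfold wallRate
  exact Real.exp_le_exp.2 (by linarith)

/-! ### The a priori bound `β(y) ≤ μ_ℍ √(max(1,y))` -/

/-- `d_k(y) ≤ y · μ_ℍ · e^{6√(2k−2)} · μ_ℍ^{2k−2} · max(1,y)^{k−1}` for `k ≥ 1`.
[cite: MadrasSlade1993, §1.2, Lemma 1.2.2 (boundedness); HammersleyWelsh1962, Theorem] -/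
theorem wallSeq_le_parity (hy : 0 < y) {k : ℕ} (hk : 1 ≤ k) :
    wallSeq y k ≤ y * (hexConnectiveConstant * Real.exp (6 * Real.sqrt (2 * k - 2 : ℕ)) *
      hexConnectiveConstant ^ (2 * k - 2)) * max 1 y ^ (k - 1) := by
  rw [wallSeq, if_neg (by omega : k ≠ 0)]
  have h1 := WB_le_card_mul_pow_div_two (2 * k - 2) hy.le
  rw [show (2 * k - 2) / 2 = k - 1 by omega] at h1
  have h2 : (#(saws (2 * k - 2)) : ℝ) ≤ hexConnectiveConstant * Real.exp (6 * Real.sqrt (2 * k - 2 : ℕ)) *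
      hexConnectiveConstant ^ (2 * k - 2) := by
    rw [card_saws]; exact hexSawCount_le_mu_mul_exp_mul_pow (2 * k - 2)
  have hM : 0 ≤ max 1 y ^ (k - 1) := pow_nonneg (zero_le_one.trans (le_max_left _ _)) _
  rw [mul_assoc]
  exact mul_le_mul_of_nonneg_left (h1.trans (mul_le_mul_of_nonneg_right h2 hM)) hy.le

/-- **`β(y) ≤ μ_ℍ · √(max(1,y))`** for every `y > 0`: in the exponential rate only every other vertex can be weighted.
[cite: BeatonBousquetMelouDeGierDuminilCopinGuttmann2014, §3.1, Proposition 5 (arXiv v5 p. 9: "1 ≤ y_c ≤ μ²"; p. 10, top: "μ(y) ∼ √y in our honeycomb setting")] -/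
theorem wallRate_le_mul_sqrt (hy : 0 < y) : wallRate y ≤ hexConnectiveConstant * Real.sqrt (max 1 y) := by
  set μ := hexConnectiveConstant with hμdef
  set M := max 1 y with hMdef
  have hμ : 0 < μ := hexConnectiveConstant_pos
  have hM1 : 1 ≤ M := le_max_left _ _
  have hM0 : 0 < M := lt_of_lt_of_le one_pos hM1
  by_contra hcon
  have hcon' : μ * Real.sqrt M < wallRate y := lt_of_not_ge hcon
  -- pick `r` strictly between `μ √M` and `β(y)`
  obtain ⟨r, hr1, hr2⟩ := exists_between hcon'
  have hr0 : 0 < r := lt_of_le_of_lt (by positivity) hr1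
  -- `s := r² / (μ² M) > 1`
  have hμM : 0 < μ ^ 2 * M := by positivity
  have hs : 1 < r ^ 2 / (μ ^ 2 * M) := by
    rw [one_lt_div hμM]
    have h1 : (μ * Real.sqrt M) ^ 2 = μ ^ 2 * M := by
      rw [mul_pow, Real.sq_sqrt hM0.le]
    rw [← h1]
    exact pow_lt_pow_left₀ hr1 (by positivity) two_ne_zero
  -- eventually `(r²)^k ≤ d_k ≤ (y μ / (μ² M)) · e^{6√2 √k} · (μ² M)^k`
  have hev1 := eventually_pow_le_wallSeq hy hr0 hr2
  set C := y * μ / (μ ^ 2 * M) with hCdef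
  have hC : 0 < C := by positivity
  have hev2 := eventually_mul_exp_sqrt_le_pow hs (2 * C) (6 * Real.sqrt 2)
  obtain ⟨k, hk1, hk2, hk3⟩ := (hev1.and (hev2.and (Filter.eventually_ge_atTop 1))).exists
  have hk3' : (1 : ℝ) ≤ k := by exact_mod_cast hk3
  -- the upper bound on `d_k`
  have hup := wallSeq_le_parity hy hk3
  have hsq : Real.sqrt (2 * k - 2 : ℕ) ≤ Real.sqrt 2 * Real.sqrt k := by
    rw [← Real.sqrt_mul (by norm_num : (0:ℝ) ≤ 2)]
    apply Real.sqrt_le_sqrt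
    have : ((2 * k - 2 : ℕ) : ℝ) ≤ 2 * k := by
      have h : 2 * k - 2 ≤ 2 * k := Nat.sub_le _ _
      exact_mod_cast h
    exact this
  have hexp : Real.exp (6 * Real.sqrt (2 * k - 2 : ℕ)) ≤ Real.exp (6 * Real.sqrt 2 * Real.sqrt k) :=
    Real.exp_le_exp.2 (by nlinarith [Real.sqrt_nonneg (2 * k - 2 : ℕ)])
  have hpow : μ ^ (2 * k - 2) * M ^ (k - 1) = (μ ^ 2 * M) ^ k / (μ ^ 2 * M) := by
    rw [eq_div_iff hμM.ne', mul_pow, ← pow_mul]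
    have e1 : μ ^ (2 * k - 2) * μ ^ 2 = μ ^ (2 * k) := by rw [← pow_add]; congr 1; omega
    have e2 : M ^ (k - 1) * M = M ^ k := by rw [← pow_succ]; congr 1; omega
    calc μ ^ (2 * k - 2) * M ^ (k - 1) * (μ ^ 2 * M) = (μ ^ (2 * k - 2) * μ ^ 2) * (M ^ (k - 1) * M) := by ring
      _ = μ ^ (2 * k) * M ^ k := by rw [e1, e2]
  have hup' : wallSeq y k ≤ C * Real.exp (6 * Real.sqrt 2 * Real.sqrt k) * (μ ^ 2 * M) ^ k := by
    calc wallSeq y k ≤ y * (μ * Real.exp (6 * Real.sqrt (2 * k - 2 : ℕ)) * μ ^ (2 * k - 2)) * M ^ (k - 1) := hup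
      _ = y * μ * Real.exp (6 * Real.sqrt (2 * k - 2 : ℕ)) * (μ ^ (2 * k - 2) * M ^ (k - 1)) := by ring
      _ ≤ y * μ * Real.exp (6 * Real.sqrt 2 * Real.sqrt k) * (μ ^ (2 * k - 2) * M ^ (k - 1)) := by
          gcongr
      _ = C * Real.exp (6 * Real.sqrt 2 * Real.sqrt k) * (μ ^ 2 * M) ^ k := by
          rw [hpow, hCdef]; field_simp
  -- combine: `s^k ≤ C e^{…}` and `2 C e^{…} ≤ s^k`
  have hsk : (r ^ 2 / (μ ^ 2 * M)) ^ k * (μ ^ 2 * M) ^ k = (r ^ 2) ^ k := by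
    rw [← mul_pow, div_mul_cancel₀ _ hμM.ne']
  have hMk : 0 < (μ ^ 2 * M) ^ k := pow_pos hμM k
  have h3' : (r ^ 2 / (μ ^ 2 * M)) ^ k * (μ ^ 2 * M) ^ k ≤
      C * Real.exp (6 * Real.sqrt 2 * Real.sqrt k) * (μ ^ 2 * M) ^ k := by
    rw [hsk]; exact hk1.trans hup'
  have h3 : (r ^ 2 / (μ ^ 2 * M)) ^ k ≤ C * Real.exp (6 * Real.sqrt 2 * Real.sqrt k) :=
    le_of_mul_le_mul_right h3' hMk
  have hE : 0 < Real.exp (6 * Real.sqrt 2 * Real.sqrt k) := Real.exp_pos _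
  nlinarith [hk2, h3, mul_pos hC hE]

/-! ### Hölder: log-convexity in `log y` -/

/-- **Hölder on the wall-bridge sums**: `B^w_m(y₁^θ y₂^{1−θ}) ≤ B^w_m(y₁)^θ · B^w_m(y₂)^{1−θ}` for `0 < θ < 1`.
[cite: BeatonBousquetMelouDeGierDuminilCopinGuttmann2014, §3.1, Proposition 5 (arXiv v5 p. 9: log-convexity); HammersleyTorrieWhittington1982, §2] -/
theorem WB_rpow_mul_rpow_le (m : ℕ) {y₁ y₂ θ : ℝ} (h₁ : 0 < y₁) (h₂ : 0 < y₂) (hθ0 : 0 < θ) (hθ1 : θ < 1) :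
    WB m (y₁ ^ θ * y₂ ^ (1 - θ)) ≤ WB m y₁ ^ θ * WB m y₂ ^ (1 - θ) := by
  have hθ' : 0 < 1 - θ := by linarith
  set f : (ℕ → Site 2) → ℝ := fun ω => (y₁ ^ visits m ω) ^ θ with hf
  set g : (ℕ → Site 2) → ℝ := fun ω => (y₂ ^ visits m ω) ^ (1 - θ) with hg
  have hf0 : ∀ ω, 0 ≤ f ω := fun ω => Real.rpow_nonneg (pow_nonneg h₁.le _) _
  have hg0 : ∀ ω, 0 ≤ g ω := fun ω => Real.rpow_nonneg (pow_nonneg h₂.le _) _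
  have hterm : ∀ ω : ℕ → Site 2, (y₁ ^ θ * y₂ ^ (1 - θ)) ^ visits m ω = f ω * g ω := by
    intro ω
    rw [hf, hg]; simp only
    rw [mul_pow, ← Real.rpow_natCast (y₁ ^ θ), ← Real.rpow_natCast (y₂ ^ (1 - θ)),
      ← Real.rpow_mul h₁.le, ← Real.rpow_mul h₂.le, mul_comm θ, mul_comm (1 - θ),
      Real.rpow_mul h₁.le, Real.rpow_mul h₂.le, Real.rpow_natCast, Real.rpow_natCast]
  have hpq : (θ⁻¹).HolderConjugate (1 - θ)⁻¹ := Real.HolderConjugate.inv_one_sub_inv hθ0 hθ1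
  have hH := Real.inner_le_Lp_mul_Lq_of_nonneg (wbr m) (f := f) (g := g) hpq (fun ω _ => hf0 ω) (fun ω _ => hg0 ω)
  have hfp : ∀ ω, f ω ^ θ⁻¹ = y₁ ^ visits m ω := fun ω => by
    rw [hf]; simp only
    rw [← Real.rpow_mul (pow_nonneg h₁.le _), mul_inv_cancel₀ hθ0.ne', Real.rpow_one]
  have hgq : ∀ ω, g ω ^ (1 - θ)⁻¹ = y₂ ^ visits m ω := fun ω => by
    rw [hg]; simp only
    rw [← Real.rpow_mul (pow_nonneg h₂.le _), mul_inv_cancel₀ hθ'.ne', Real.rpow_one]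
  unfold WB
  rw [Finset.sum_congr rfl fun ω _ => hterm ω]
  rw [Finset.sum_congr rfl fun ω _ => hfp ω, Finset.sum_congr rfl fun ω _ => hgq ω, one_div, one_div,
    inv_inv, inv_inv] at hH
  exact hH

/-- Hölder for the shifted sequence: `d_k(y₁^θ y₂^{1−θ}) ≤ d_k(y₁)^θ · d_k(y₂)^{1−θ}`.
[cite: BeatonBousquetMelouDeGierDuminilCopinGuttmann2014, §3.1, Proposition 5 (arXiv v5 p. 9: log-convexity); MadrasSlade1993, §1.2, Lemma 1.2.2] -/
theorem wallSeq_rpow_mul_rpow_le (k : ℕ) {y₁ y₂ θ : ℝ} (h₁ : 0 < y₁) (h₂ : 0 < y₂) (hθ0 : 0 < θ) (hθ1 : θ < 1) :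
    wallSeq (y₁ ^ θ * y₂ ^ (1 - θ)) k ≤ wallSeq y₁ k ^ θ * wallSeq y₂ k ^ (1 - θ) := by
  unfold wallSeq
  split_ifs with hk
  · rw [Real.one_rpow, Real.one_rpow, mul_one]
  · have hW := WB_rpow_mul_rpow_le (2 * k - 2) h₁ h₂ hθ0 hθ1
    have hy : 0 ≤ y₁ ^ θ * y₂ ^ (1 - θ) := mul_nonneg (Real.rpow_nonneg h₁.le _) (Real.rpow_nonneg h₂.le _)
    calc y₁ ^ θ * y₂ ^ (1 - θ) * WB (2 * k - 2) (y₁ ^ θ * y₂ ^ (1 - θ))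
        ≤ y₁ ^ θ * y₂ ^ (1 - θ) * (WB (2 * k - 2) y₁ ^ θ * WB (2 * k - 2) y₂ ^ (1 - θ)) :=
          mul_le_mul_of_nonneg_left hW hy
      _ = (y₁ * WB (2 * k - 2) y₁) ^ θ * (y₂ * WB (2 * k - 2) y₂) ^ (1 - θ) := by
          rw [Real.mul_rpow h₁.le (WB_nonneg _ h₁.le), Real.mul_rpow h₂.le (WB_nonneg _ h₂.le)]; ring

/-- **`β` is log-convex in `log y`**: `β(y₁^θ y₂^{1−θ}) ≤ β(y₁)^θ · β(y₂)^{1−θ}` for `0 < θ < 1`.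
[cite: BeatonBousquetMelouDeGierDuminilCopinGuttmann2014, §3.1, Proposition 5 (arXiv v5 p. 9: "a log-convex … function of log y"); HammersleyTorrieWhittington1982, §2] -/
theorem wallRate_rpow_mul_rpow_le {y₁ y₂ θ : ℝ} (h₁ : 0 < y₁) (h₂ : 0 < y₂) (hθ0 : 0 < θ) (hθ1 : θ < 1) :
    wallRate (y₁ ^ θ * y₂ ^ (1 - θ)) ≤ wallRate y₁ ^ θ * wallRate y₂ ^ (1 - θ) := by
  have hθ' : 0 < 1 - θ := by linarith
  have hy : 0 < y₁ ^ θ * y₂ ^ (1 - θ) := mul_pos (Real.rpow_pos_of_pos h₁ _) (Real.rpow_pos_of_pos h₂ _)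
  -- compare the Fekete limits: `θ ℓ(y₁) + (1−θ) ℓ(y₂) ≤ ℓ(y₁^θ y₂^{1−θ})`
  have hlim : θ * wallLogLim y₁ + (1 - θ) * wallLogLim y₂ ≤ wallLogLim (y₁ ^ θ * y₂ ^ (1 - θ)) := by
    refine le_of_tendsto_of_tendsto (((tendsto_wallU_div h₁).const_mul θ).add
      ((tendsto_wallU_div h₂).const_mul (1 - θ))) (tendsto_wallU_div hy) ?_
    filter_upwards [Filter.eventually_ge_atTop 1] with k hk
    have hk' : (0 : ℝ) < k := by exact_mod_cast hk
    rw [← mul_div_assoc, ← mul_div_assoc, ← add_div]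
    apply div_le_div_of_nonneg_right _ hk'.le
    simp only [wallU]
    have hW := wallSeq_rpow_mul_rpow_le k h₁ h₂ hθ0 hθ1
    have hlog := Real.log_le_log (wallSeq_pos hy k) hW
    rw [Real.log_mul (Real.rpow_pos_of_pos (wallSeq_pos h₁ k) _).ne' (Real.rpow_pos_of_pos (wallSeq_pos h₂ k) _).ne',
      Real.log_rpow (wallSeq_pos h₁ k), Real.log_rpow (wallSeq_pos h₂ k)] at hlog
    linarith
  unfold wallRate
  rw [← Real.exp_mul, ← Real.exp_mul, ← Real.exp_add]
  exact Real.exp_le_exp.2 (by nlinarith)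

/-- **`t ↦ log β(eᵗ)` is convex on `ℝ`.**
[cite: BeatonBousquetMelouDeGierDuminilCopinGuttmann2014, §3.1, Proposition 5 (arXiv v5 p. 9: "a log-convex, non-decreasing function of log y")] -/
theorem convexOn_log_wallRate_exp : ConvexOn ℝ Set.univ (fun t : ℝ => Real.log (wallRate (Real.exp t))) := by
  refine ⟨convex_univ, fun x _ z _ a b ha hb hab => ?_⟩
  simp only [smul_eq_mul]
  rcases ha.eq_or_lt with rfl | ha'
  · simp only [zero_mul, zero_add] at hab ⊢; subst hab; simp
  rcases hb.eq_or_lt with rfl | hb'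
  · simp only [zero_mul, add_zero] at hab ⊢; subst hab; simp
  have ha1 : a < 1 := by linarith
  have hb_eq : b = 1 - a := by linarith
  subst hb_eq
  have hexp : Real.exp (a * x + (1 - a) * z) = Real.exp x ^ a * Real.exp z ^ (1 - a) := by
    rw [Real.exp_add, mul_comm a x, mul_comm (1 - a) z, Real.exp_mul, Real.exp_mul]
  rw [hexp]
  have h := wallRate_rpow_mul_rpow_le (Real.exp_pos x) (Real.exp_pos z) ha' ha1
  have hlog := Real.log_le_log (wallRate_pos _) h
  rw [Real.log_mul (Real.rpow_pos_of_pos (wallRate_pos _) _).ne' (Real.rpow_pos_of_pos (wallRate_pos _) _).ne',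
    Real.log_rpow (wallRate_pos _), Real.log_rpow (wallRate_pos _)] at hlog
  exact hlog

/-! ### The main statement: `β(y)/√y` is non-increasing -/

/-- The convex function `t ↦ log β(eᵗ)` lies below the line `log μ_ℍ + t/2` for `t ≥ 0`.
[cite: BeatonBousquetMelouDeGierDuminilCopinGuttmann2014, §3.1, Proposition 5 (arXiv v5 pp. 9–10: "μ(y) ∼ √y in our honeycomb setting", top of p. 10)] -/
theorem log_wallRate_exp_le {t : ℝ} (ht : 0 ≤ t) :
    Real.log (wallRate (Real.exp t)) ≤ Real.log hexConnectiveConstant + t / 2 := by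
  have hμ := hexConnectiveConstant_pos
  have h := wallRate_le_mul_sqrt (Real.exp_pos t)
  have hmax : max 1 (Real.exp t) = Real.exp t := max_eq_right (Real.one_le_exp ht)
  rw [hmax, Real.sqrt_eq_rpow, ← Real.exp_mul] at h
  have hlog := Real.log_le_log (wallRate_pos _) h
  rw [Real.log_mul hμ.ne' (Real.exp_pos _).ne', Real.log_exp] at hlog
  linarith

/-- **Every chord of `t ↦ log β(eᵗ)` has slope at most `1/2`.**
[cite: BeatonBousquetMelouDeGierDuminilCopinGuttmann2014, §3.1, Proposition 5 (arXiv v5 p. 9: log-convexity; p. 10, top: "μ(y) ∼ √y")] -/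
theorem log_wallRate_exp_sub_le {t t' : ℝ} (htt' : t ≤ t') :
    Real.log (wallRate (Real.exp t')) - Real.log (wallRate (Real.exp t)) ≤ (t' - t) / 2 := by
  rcases htt'.eq_or_lt with rfl | hlt
  · simp
  set f : ℝ → ℝ := fun s => Real.log (wallRate (Real.exp s)) with hfdef
  have hconv : ConvexOn ℝ Set.univ f := convexOn_log_wallRate_exp
  by_contra hcon
  have hcon' : (t' - t) / 2 < Real.log (wallRate (Real.exp t')) - Real.log (wallRate (Real.exp t)) :=
    lt_of_not_ge hcon
  -- the slope `m₀ > 1/2` of the chord `[t, t']`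
  set m₀ := (f t' - f t) / (t' - t) with hm₀
  have hpos : 0 < t' - t := sub_pos.2 hlt
  have hm : 1 / 2 < m₀ := by
    rw [hm₀, lt_div_iff₀ hpos]
    have : (t' - t) / 2 < f t' - f t := hcon'
    linarith
  -- every later chord `[t', z]` has slope `≥ m₀`, hence `f z ≥ f t' + m₀ (z − t')`; but `f z ≤ log μ + z/2`
  set K := Real.log hexConnectiveConstant + m₀ * t' - f t' with hK
  set z := max (max t' 0) ((K + 1) / (m₀ - 1 / 2)) + 1 with hz
  have hzt' : t' < z := by
    have : t' ≤ max (max t' 0) ((K + 1) / (m₀ - 1 / 2)) := (le_max_left _ _).trans (le_max_left _ _)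
    linarith
  have hz0 : 0 ≤ z := by
    have : (0:ℝ) ≤ max (max t' 0) ((K + 1) / (m₀ - 1 / 2)) := (le_max_right _ _).trans (le_max_left _ _)
    linarith
  have hzK : (K + 1) / (m₀ - 1 / 2) < z := by
    have : (K + 1) / (m₀ - 1 / 2) ≤ max (max t' 0) ((K + 1) / (m₀ - 1 / 2)) := le_max_right _ _
    linarith
  have hslope := hconv.slope_mono_adjacent (Set.mem_univ t) (Set.mem_univ z) hlt hzt'
  -- `m₀ ≤ (f z − f t')/(z − t')`
  have hzt : 0 < z - t' := sub_pos.2 hzt'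
  have h1 : m₀ * (z - t') ≤ f z - f t' := by
    rw [hm₀]; exact (le_div_iff₀ hzt).1 hslope
  have h2 : f z ≤ Real.log hexConnectiveConstant + z / 2 := log_wallRate_exp_le hz0
  -- so `(m₀ − 1/2) z ≤ K`
  have h3 : (m₀ - 1 / 2) * z ≤ K := by rw [hK]; linarith
  have hm' : 0 < m₀ - 1 / 2 := by linarith
  rw [div_lt_iff₀ hm'] at hzK
  linarith

/-- **`β(y') ≤ √(y'/y) · β(y)` for `0 < y ≤ y'`**: the wall-bridge rate grows at most like `√y`.
[cite: BeatonBousquetMelouDeGierDuminilCopinGuttmann2014, §3.1, Proposition 5 (arXiv v5 p. 9: log-convexity; p. 10, top: "μ(y) ∼ √y in our honeycomb setting")] -/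
theorem wallRate_le_sqrt_mul (hy : 0 < y) {y' : ℝ} (hyy' : y ≤ y') :
    wallRate y' ≤ Real.sqrt (y' / y) * wallRate y := by
  have hy' : 0 < y' := lt_of_lt_of_le hy hyy'
  have h := log_wallRate_exp_sub_le (Real.log_le_log hy hyy')
  rw [Real.exp_log hy, Real.exp_log hy'] at h
  have hβ := wallRate_pos y
  have hβ' := wallRate_pos y'
  rw [← Real.log_le_log_iff hβ' (by positivity), Real.log_mul (Real.sqrt_pos.2 (by positivity)).ne' hβ.ne',
    Real.log_sqrt (by positivity), Real.log_div hy'.ne' hy.ne']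
  linarith

/-- **`β(y)/√y` is non-increasing on `(0, ∞)`.**
[cite: BeatonBousquetMelouDeGierDuminilCopinGuttmann2014, §3.1, Proposition 5 (arXiv v5 p. 9)] -/
theorem antitoneOn_wallRate_div_sqrt : AntitoneOn (fun y : ℝ => wallRate y / Real.sqrt y) (Set.Ioi 0) := by
  intro y hy y' _ hyy'
  have hy0 : (0:ℝ) < y := hy
  have hy' : 0 < y' := lt_of_lt_of_le hy0 hyy'
  have h := wallRate_le_sqrt_mul hy0 hyy'
  have hsy' : 0 < Real.sqrt y' := Real.sqrt_pos.2 hy'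
  rw [Real.sqrt_div hy'.le] at h
  show wallRate y' / Real.sqrt y' ≤ wallRate y / Real.sqrt y
  rw [div_le_iff₀ hsy']
  calc wallRate y' ≤ Real.sqrt y' / Real.sqrt y * wallRate y := h
    _ = wallRate y / Real.sqrt y * Real.sqrt y' := by ring

/-- **Two-sided form**: `0 ≤ log β(y') − log β(y) ≤ (log y' − log y)/2` for `0 < y ≤ y'`.
[cite: BeatonBousquetMelouDeGierDuminilCopinGuttmann2014, §3.1, Proposition 5 (arXiv v5 p. 9)] -/
theorem log_wallRate_sub_log_wallRate_mem_Icc (hy : 0 < y) {y' : ℝ} (hyy' : y ≤ y') :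
    Real.log (wallRate y') - Real.log (wallRate y) ∈ Set.Icc 0 ((Real.log y' - Real.log y) / 2) := by
  have hy' : 0 < y' := lt_of_lt_of_le hy hyy'
  constructor
  · exact sub_nonneg.2 (Real.log_le_log (wallRate_pos y) (wallRate_mono hy hyy'))
  · have h := log_wallRate_exp_sub_le (Real.log_le_log hy hyy')
    rwa [Real.exp_log hy, Real.exp_log hy'] at h

/-! ### Continuity and almost-everywhere differentiability of `β` -/

/-- `β` is monotone on `(0, ∞)`. [cite: BeatonBousquetMelouDeGierDuminilCopinGuttmann2014, §3.1, Proposition 5 (arXiv v5 p. 9: "non-decreasing")] -/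
theorem monotoneOn_wallRate : MonotoneOn wallRate (Set.Ioi 0) := fun _ hy _ _ h => wallRate_mono hy h

/-- **`β` is continuous at every `y₀ > 0`**: squeezed between `min(β(y₀), √(y/y₀) β(y₀))` and `max(β(y₀), √(y/y₀) β(y₀))`.
[cite: BeatonBousquetMelouDeGierDuminilCopinGuttmann2014, §3.1, Proposition 5 (arXiv v5 p. 9: "and therefore continuous")] -/
theorem continuousAt_wallRate {y₀ : ℝ} (hy₀ : 0 < y₀) : ContinuousAt wallRate y₀ := by
  set g : ℝ → ℝ := fun y => Real.sqrt (y / y₀) * wallRate y₀ with hg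
  have hg1 : Tendsto g (𝓝 y₀) (𝓝 (wallRate y₀)) := by
    have h1 : Tendsto (fun y : ℝ => Real.sqrt (y / y₀)) (𝓝 y₀) (𝓝 1) := by
      have h := ((continuous_id.div_const y₀).sqrt).tendsto y₀
      simpa [div_self hy₀.ne'] using h
    simpa [hg] using h1.mul_const (wallRate y₀)
  have hlo : Tendsto (fun y => min (wallRate y₀) (g y)) (𝓝 y₀) (𝓝 (wallRate y₀)) := by
    simpa using (tendsto_const_nhds (x := wallRate y₀)).min hg1
  have hhi : Tendsto (fun y => max (wallRate y₀) (g y)) (𝓝 y₀) (𝓝 (wallRate y₀)) := by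
    simpa using (tendsto_const_nhds (x := wallRate y₀)).max hg1
  have hpos : ∀ᶠ y in 𝓝 y₀, 0 < y := Ioi_mem_nhds hy₀
  refine tendsto_of_tendsto_of_tendsto_of_le_of_le' hlo hhi ?_ ?_
  · filter_upwards [hpos] with y hy
    rcases le_total y₀ y with h | h
    · exact (min_le_left _ _).trans (wallRate_mono hy₀ h)
    · refine (min_le_right _ _).trans ?_
      -- `β(y₀) ≤ √(y₀/y) β(y)` ⇒ `√(y/y₀) β(y₀) ≤ β(y)`
      have h1 := wallRate_le_sqrt_mul hy h
      have hs : Real.sqrt (y / y₀) * Real.sqrt (y₀ / y) = 1 := by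
        rw [← Real.sqrt_mul (div_nonneg hy.le hy₀.le), div_mul_div_comm, mul_comm y y₀, div_self (by positivity),
          Real.sqrt_one]
      calc g y = Real.sqrt (y / y₀) * wallRate y₀ := rfl
        _ ≤ Real.sqrt (y / y₀) * (Real.sqrt (y₀ / y) * wallRate y) :=
            mul_le_mul_of_nonneg_left h1 (Real.sqrt_nonneg _)
        _ = wallRate y := by rw [← mul_assoc, hs, one_mul]
  · filter_upwards [hpos] with y hy
    rcases le_total y₀ y with h | h
    · exact (wallRate_le_sqrt_mul hy₀ h).trans (le_max_right _ _)
    · exact (wallRate_mono hy h).trans (le_max_left _ _)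

/-- **`β` is continuous on `(0, ∞)`.** [cite: BeatonBousquetMelouDeGierDuminilCopinGuttmann2014, §3.1, Proposition 5 (arXiv v5 p. 9: "and therefore continuous")] -/
theorem continuousOn_wallRate : ContinuousOn wallRate (Set.Ioi 0) :=
  fun _ hy => (continuousAt_wallRate hy).continuousWithinAt

/-- **`β` is differentiable at almost every `y > 0`** (Lebesgue's theorem for the monotone `β`).
[cite: BeatonBousquetMelouDeGierDuminilCopinGuttmann2014, §3.1, Proposition 5 (arXiv v5 p. 9: "and almost everywhere differentiable")] -/
theorem ae_differentiableAt_wallRate : ∀ᵐ y : ℝ, 0 < y → DifferentiableAt ℝ wallRate y :=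
  (monotoneOn_wallRate.ae_differentiableWithinAt_of_mem).mono fun _ h hy => (h hy).differentiableAt (Ioi_mem_nhds hy)

/-! ### The surface density is at most `1/2` -/

/-- Calculus: if `0 < a ≤ b → f b ≤ √(b/a) · f a` then `y · f'(y) ≤ f(y)/2` at every `y > 0` where `f` is differentiable
(the auxiliary `φ(y') = √(y'/y) f(y) − f(y')` vanishes at `y`, is `≤ 0` to the left and `≥ 0` to the right, so `φ'(y) ≥ 0`).
[cite: BeatonBousquetMelouDeGierDuminilCopinGuttmann2014, §3.1 (arXiv v5 pp. 9–10: the mean density of surface vertices tends to y ∂ log μ(y)/∂y); lane plumbing, not in print] -/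
theorem mul_deriv_le_half_of_sqrt_law (f : ℝ → ℝ) (hy : 0 < y)
    (hlaw : ∀ {a b : ℝ}, 0 < a → a ≤ b → f b ≤ Real.sqrt (b / a) * f a)
    (hd : DifferentiableAt ℝ f y) : y * deriv f y ≤ f y / 2 := by
  set φ : ℝ → ℝ := fun y' => Real.sqrt (y' / y) * f y - f y' with hφ
  have hsq : HasDerivAt (fun y' : ℝ => Real.sqrt (y' / y)) (1 / (2 * y)) y := by
    have h1 : HasDerivAt (fun y' : ℝ => y' / y) (1 / y) y := by
      simpa using (hasDerivAt_id y).div_const y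
    have h2 := h1.sqrt (by rw [div_self hy.ne']; exact one_ne_zero)
    have e : (1 / y) / (2 * Real.sqrt (y / y)) = 1 / (2 * y) := by
      rw [div_self hy.ne', Real.sqrt_one]; field_simp
    rw [e] at h2; exact h2
  have hφd : HasDerivAt φ (1 / (2 * y) * f y - deriv f y) y := (hsq.mul_const (f y)).sub hd.hasDerivAt
  have hφ0 : φ y = 0 := by simp [hφ, div_self hy.ne']
  have hslope : ∀ᶠ y' in 𝓝[≠] y, 0 ≤ slope φ y y' := by
    have hpos' : ∀ᶠ y' in 𝓝[≠] y, 0 < y' ∧ y' ≠ y := by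
      have h1 : ∀ᶠ y' in 𝓝[≠] y, 0 < y' := nhdsWithin_le_nhds (Ioi_mem_nhds hy)
      have h2 : ∀ᶠ y' in 𝓝[≠] y, y' ≠ y := self_mem_nhdsWithin
      exact h1.and h2
    filter_upwards [hpos'] with y' hy'
    obtain ⟨hy'0, hne⟩ := hy'
    rw [slope_def_field, hφ0, sub_zero]
    rcases lt_or_gt_of_ne hne with hlt | hgt
    · have h := hlaw hy'0 hlt.le
      have hs : Real.sqrt (y' / y) * Real.sqrt (y / y') = 1 := by
        rw [← Real.sqrt_mul (div_nonneg hy'0.le hy.le), div_mul_div_comm, mul_comm y' y, div_self (by positivity),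
          Real.sqrt_one]
      have hφle : φ y' ≤ 0 := by
        simp only [hφ]
        have : Real.sqrt (y' / y) * f y ≤ f y' := by
          calc Real.sqrt (y' / y) * f y ≤ Real.sqrt (y' / y) * (Real.sqrt (y / y') * f y') :=
                mul_le_mul_of_nonneg_left h (Real.sqrt_nonneg _)
            _ = f y' := by rw [← mul_assoc, hs, one_mul]
        linarith
      exact div_nonneg_of_nonpos (by linarith) (by linarith)
    · have h := hlaw hy hgt.le
      have hφge : 0 ≤ φ y' := by simp only [hφ]; linarith
      exact div_nonneg hφge (by linarith)
  have h0 : 0 ≤ 1 / (2 * y) * f y - deriv f y := ge_of_tendsto hφd.tendsto_slope hslope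
  have e : 1 / (2 * y) * f y = f y / 2 / y := by field_simp
  rw [e] at h0
  have : deriv f y ≤ f y / 2 / y := by linarith
  calc y * deriv f y ≤ y * (f y / 2 / y) := mul_le_mul_of_nonneg_left this hy.le
    _ = f y / 2 := by field_simp

/-- **The surface density of wall bridges is at most `1/2`: `y · β'(y) ≤ β(y)/2`** at every `y > 0` where `β` is differentiable
(almost every `y`, by `ae_differentiableAt_wallRate`); i.e. `y ∂ log β(y)/∂y ≤ 1/2`, the macroscopic form of "surface visits at
even times only". [cite: BeatonBousquetMelouDeGierDuminilCopinGuttmann2014, §3.1 (arXiv v5 pp. 9–10: "the mean density of vertices in the surface … tends to y ∂ log μ(y)/∂y … is 0 for y < y_c and is positive for y > y_c")] -/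
theorem mul_deriv_wallRate_le_half (hy : 0 < y) (hd : DifferentiableAt ℝ wallRate y) :
    y * deriv wallRate y ≤ wallRate y / 2 :=
  mul_deriv_le_half_of_sqrt_law wallRate hy (fun ha hab => wallRate_le_sqrt_mul ha hab) hd

end Literature.Probability.RandomPlanarGeometry.SAW.HexBW.Wall
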